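import Mathlib
import HarnessLib
import Summits.HubbardSuperconductivity.HubbardSuperconductivity.Theorems.KLProgrammeSalmhoferCutoffThirdDerivBound
import Summits.HubbardSuperconductivity.HubbardSuperconductivity.Theorems.KLProgrammeKLRegimeSplitCutoffNumeralsTier1

/-!
# Route `KLProgramme` — engine-flow child (stmt-HubbardSuperconductivity-20437), stub (C) far part: an EXPLICIT bound on the FOURTH derivative of
# Salmhofer's cutoff, `|χ₂⁗| ≤ (256/81)·169536·e² (< 3.96·10⁶)` — completes the cutoff numerals to order 4 (`klCutoffX4`'s job, with a number)

Cell gate-hubbard-kl, seat hubbard-kl-k3c3-p3 (g6).  One more differentiation of `σ‴ = σ(1−σ)[(1−6σ+6σ²)h³ + 3(1−2σ)hh′ + h″]` (`…ThirdDerivBound`):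
  `σ⁗ = σ(1−σ)·[(1 − 14σ + 36σ² − 24σ³)h⁴ + 6(1 − 6σ + 6σ²)h²h′ + (1 − 2σ)(3h′² + 4hh″) + h‴]`,
all polynomial coefficients bounded by `1` in absolute value on `σ ∈ [0,1]`, so `|σ⁗| ≤ σ(1−σ)(h⁴ + 6h²|h′| + 3h′² + 4hh″ + |h‴|) ≤ 169536·e²`
(`σ(1−σ) ≤ min(E, E⁻¹)`, `uᵏe^{−u} ≤ k!`).  §1 `kltd_hasDerivAt_hh2`, `kltd_hasDerivAt_D3`, **`kltd_deriv4_eq`**; §2 `kltd_core4_bound`;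
§3 **`kltd_abs_deriv4_smoothTransition_le`**, **`kltd_abs_deriv4_salmhoferCutoff_le`** (`(256/81)·169536·e²`), `…_lt` (`< 3960000`),
`norm_iteratedFDeriv_four_salmhoferCutoff_le`, and the TIER-2 package **`norm_iteratedFDeriv_salmhoferCutoff_le_of_le_four`**: `‖Dˡχ₂‖ ≤ 3960000` for every
`l ≤ 4` (orders ≤ 2: `1110`, p1b's tier-1; order 3: `44900`).  Crude by ≈ 10³ against the truth; enough where the far mass is `≤ 10⁻⁴`.
Everything is proved; no definitions.  References: Salmhofer 1999 §4.2.5 (4.70)–(4.71); [cite: BenfattoGiulianiMastropietro2006] §2.2.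
-/

noncomputable section

namespace Summit.HubbardSuperconductivity.HubbardSuperconductivity.Theorems.KLRegimeSplit

set_option linter.dupNamespace false -- summit = problem name (single-conjunct summit), D-0017

open Real Set Filter Literature.MathematicalPhysics.QuantumLattice
open scoped Topology

/-! ## §1 The fourth derivative on `(0,1)` -/

/-- `h‴ = −24x⁻⁵ + 24(1−x)⁻⁵`. -/
theorem kltd_hasDerivAt_hh2 {x : ℝ} (hx0 : x ≠ 0) (hx1 : 1 - x ≠ 0) :
    HasDerivAt (fun y : ℝ => 6 * (y⁻¹) ^ 4 + 6 * ((1 - y)⁻¹) ^ 4) (-24 * (x⁻¹) ^ 5 + 24 * ((1 - x)⁻¹) ^ 5) x := by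
  have h := ((kltd_hasDerivAt_invPow 3 hx0).const_mul 6).add ((kltd_hasDerivAt_oneSubInvPow 3 hx1).const_mul 6)
  refine h.congr_deriv ?_
  push_cast; ring

/-- **`σ⁗` on `(0,1)`**: the derivative of the order-3 expression. -/
theorem kltd_hasDerivAt_D3 {x : ℝ} (h0 : 0 < x) (h1 : x < 1) :
    HasDerivAt (fun y : ℝ =>
      (1 + Real.exp (y⁻¹ - (1 - y)⁻¹))⁻¹ * (1 - (1 + Real.exp (y⁻¹ - (1 - y)⁻¹))⁻¹) *
        ((1 - 6 * (1 + Real.exp (y⁻¹ - (1 - y)⁻¹))⁻¹ + 6 * (1 + Real.exp (y⁻¹ - (1 - y)⁻¹))⁻¹ ^ 2) *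
            ((y⁻¹) ^ 2 + ((1 - y)⁻¹) ^ 2) ^ 3 +
          3 * (1 - 2 * (1 + Real.exp (y⁻¹ - (1 - y)⁻¹))⁻¹) * ((y⁻¹) ^ 2 + ((1 - y)⁻¹) ^ 2) *
            (-2 * (y⁻¹) ^ 3 + 2 * ((1 - y)⁻¹) ^ 3) +
          (6 * (y⁻¹) ^ 4 + 6 * ((1 - y)⁻¹) ^ 4)))
      ((1 + Real.exp (x⁻¹ - (1 - x)⁻¹))⁻¹ * (1 - (1 + Real.exp (x⁻¹ - (1 - x)⁻¹))⁻¹) *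
        ((1 - 14 * (1 + Real.exp (x⁻¹ - (1 - x)⁻¹))⁻¹ + 36 * (1 + Real.exp (x⁻¹ - (1 - x)⁻¹))⁻¹ ^ 2 -
              24 * (1 + Real.exp (x⁻¹ - (1 - x)⁻¹))⁻¹ ^ 3) * ((x⁻¹) ^ 2 + ((1 - x)⁻¹) ^ 2) ^ 4 +
          6 * (1 - 6 * (1 + Real.exp (x⁻¹ - (1 - x)⁻¹))⁻¹ + 6 * (1 + Real.exp (x⁻¹ - (1 - x)⁻¹))⁻¹ ^ 2) *
            ((x⁻¹) ^ 2 + ((1 - x)⁻¹) ^ 2) ^ 2 * (-2 * (x⁻¹) ^ 3 + 2 * ((1 - x)⁻¹) ^ 3) +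
          (1 - 2 * (1 + Real.exp (x⁻¹ - (1 - x)⁻¹))⁻¹) *
            (3 * (-2 * (x⁻¹) ^ 3 + 2 * ((1 - x)⁻¹) ^ 3) ^ 2 + 4 * ((x⁻¹) ^ 2 + ((1 - x)⁻¹) ^ 2) * (6 * (x⁻¹) ^ 4 + 6 * ((1 - x)⁻¹) ^ 4)) +
          (-24 * (x⁻¹) ^ 5 + 24 * ((1 - x)⁻¹) ^ 5))) x := by
  have hx0 : x ≠ 0 := h0.ne'
  have hx1 : 1 - x ≠ 0 := by linarith
  have hs := kltd_hasDerivAt_s h0 h1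
  have hh := kltd_hasDerivAt_hh hx0 hx1
  have hh1 := kltd_hasDerivAt_hh1 hx0 hx1
  have hh2 := kltd_hasDerivAt_hh2 hx0 hx1
  have hW := hs.mul (hs.const_sub 1)
  have hA := ((hs.const_mul 6).const_sub 1).add ((hs.pow 2).const_mul 6)
  have hQ := (hs.const_mul 2).const_sub 1
  have hB := ((hQ.const_mul 3).mul hh).mul hh1
  have hP := ((hA.mul (hh.pow 3)).add hB).add hh2
  have h := hW.mul hP
  refine h.congr_deriv ?_
  simp only [Nat.cast_ofNat, show (2 : ℕ) - 1 = 1 from rfl, show (3 : ℕ) - 1 = 2 from rfl, pow_one, Pi.pow_apply, Pi.mul_apply,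
    Pi.add_apply]
  ring

/-- **`σ⁗` on `(0,1)` as an equation.** -/
theorem kltd_deriv4_eq {x : ℝ} (h0 : 0 < x) (h1 : x < 1) :
    deriv (deriv (deriv (deriv Real.smoothTransition))) x =
      (1 + Real.exp (x⁻¹ - (1 - x)⁻¹))⁻¹ * (1 - (1 + Real.exp (x⁻¹ - (1 - x)⁻¹))⁻¹) *
        ((1 - 14 * (1 + Real.exp (x⁻¹ - (1 - x)⁻¹))⁻¹ + 36 * (1 + Real.exp (x⁻¹ - (1 - x)⁻¹))⁻¹ ^ 2 -
              24 * (1 + Real.exp (x⁻¹ - (1 - x)⁻¹))⁻¹ ^ 3) * ((x⁻¹) ^ 2 + ((1 - x)⁻¹) ^ 2) ^ 4 +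
          6 * (1 - 6 * (1 + Real.exp (x⁻¹ - (1 - x)⁻¹))⁻¹ + 6 * (1 + Real.exp (x⁻¹ - (1 - x)⁻¹))⁻¹ ^ 2) *
            ((x⁻¹) ^ 2 + ((1 - x)⁻¹) ^ 2) ^ 2 * (-2 * (x⁻¹) ^ 3 + 2 * ((1 - x)⁻¹) ^ 3) +
          (1 - 2 * (1 + Real.exp (x⁻¹ - (1 - x)⁻¹))⁻¹) *
            (3 * (-2 * (x⁻¹) ^ 3 + 2 * ((1 - x)⁻¹) ^ 3) ^ 2 + 4 * ((x⁻¹) ^ 2 + ((1 - x)⁻¹) ^ 2) * (6 * (x⁻¹) ^ 4 + 6 * ((1 - x)⁻¹) ^ 4)) +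
          (-24 * (x⁻¹) ^ 5 + 24 * ((1 - x)⁻¹) ^ 5)) := by
  have hev : deriv (deriv (deriv Real.smoothTransition)) =ᶠ[𝓝 x] fun y : ℝ =>
      (1 + Real.exp (y⁻¹ - (1 - y)⁻¹))⁻¹ * (1 - (1 + Real.exp (y⁻¹ - (1 - y)⁻¹))⁻¹) *
        ((1 - 6 * (1 + Real.exp (y⁻¹ - (1 - y)⁻¹))⁻¹ + 6 * (1 + Real.exp (y⁻¹ - (1 - y)⁻¹))⁻¹ ^ 2) *
            ((y⁻¹) ^ 2 + ((1 - y)⁻¹) ^ 2) ^ 3 +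
          3 * (1 - 2 * (1 + Real.exp (y⁻¹ - (1 - y)⁻¹))⁻¹) * ((y⁻¹) ^ 2 + ((1 - y)⁻¹) ^ 2) *
            (-2 * (y⁻¹) ^ 3 + 2 * ((1 - y)⁻¹) ^ 3) +
          (6 * (y⁻¹) ^ 4 + 6 * ((1 - y)⁻¹) ^ 4)) := by
    filter_upwards [Ioo_mem_nhds h0 h1] with y hy using kltd_deriv3_eq hy.1 hy.2
  rw [hev.deriv_eq, (kltd_hasDerivAt_D3 h0 h1).deriv]

/-! ## §2 The numeric core -/

/-- **Core bound**: for `u, w > 0` with `u ≤ 2 ∨ w ≤ 2`, `E = exp(u − w)`, `hh = u² + w²`, `a = 2u³ + 2w³`, `b = 6u⁴ + 6w⁴`, `c = 24u⁵ + 24w⁵`: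
`E/(1+E)²·(hh⁴ + 6hh²a + 3a² + 4hh·b + c) ≤ 169536·e²`. -/
theorem kltd_core4_bound {u w : ℝ} (hu : 0 < u) (hw : 0 < w) (h : u ≤ 2 ∨ w ≤ 2) :
    Real.exp (u - w) / (1 + Real.exp (u - w)) ^ 2 *
        ((u ^ 2 + w ^ 2) ^ 4 + 6 * (u ^ 2 + w ^ 2) ^ 2 * (2 * u ^ 3 + 2 * w ^ 3) + 3 * (2 * u ^ 3 + 2 * w ^ 3) ^ 2 +
          4 * (u ^ 2 + w ^ 2) * (6 * u ^ 4 + 6 * w ^ 4) + (24 * u ^ 5 + 24 * w ^ 5)) ≤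
      169536 * Real.exp 2 := by
  have hE : 0 < Real.exp (u - w) := Real.exp_pos _
  have hpoly0 : 0 ≤ (u ^ 2 + w ^ 2) ^ 4 + 6 * (u ^ 2 + w ^ 2) ^ 2 * (2 * u ^ 3 + 2 * w ^ 3) + 3 * (2 * u ^ 3 + 2 * w ^ 3) ^ 2 +
      4 * (u ^ 2 + w ^ 2) * (6 * u ^ 4 + 6 * w ^ 4) + (24 * u ^ 5 + 24 * w ^ 5) := by positivity
  -- `e^{-t}·P₄(t) ≤ 169536`, `P₄(t) = t⁸ + 12t⁷ + 52t⁶ + 120t⁵ + 288t⁴ + 384t³ + 1408t² + 4864`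
  have hP : ∀ t : ℝ, 0 ≤ t →
      Real.exp (-t) * (t ^ 8 + 12 * t ^ 7 + 52 * t ^ 6 + 120 * t ^ 5 + 288 * t ^ 4 + 384 * t ^ 3 + 1408 * t ^ 2 + 4864) ≤ 169536 := by
    intro t ht
    have h8 := klsd_pow_mul_exp_neg_le 8 ht
    have h7 := klsd_pow_mul_exp_neg_le 7 ht
    have h6 := klsd_pow_mul_exp_neg_le 6 ht
    have h5 := klsd_pow_mul_exp_neg_le 5 ht
    have h4 := klsd_pow_mul_exp_neg_le 4 ht
    have h3 := klsd_pow_mul_exp_neg_le 3 ht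
    have h2 := klsd_pow_mul_exp_neg_le 2 ht
    have h0 : Real.exp (-t) ≤ 1 := by rw [Real.exp_le_one_iff]; linarith
    simp only [Nat.factorial] at h8 h7 h6 h5 h4 h3 h2
    push_cast at h8 h7 h6 h5 h4 h3 h2
    nlinarith [Real.exp_pos (-t)]
  -- the majorisation of the bracket by `P₄` of the larger variable
  have hmaj : ∀ {p q : ℝ}, 0 < p → 0 < q → p ≤ 2 →
      (p ^ 2 + q ^ 2) ^ 4 + 6 * (p ^ 2 + q ^ 2) ^ 2 * (2 * p ^ 3 + 2 * q ^ 3) + 3 * (2 * p ^ 3 + 2 * q ^ 3) ^ 2 +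
          4 * (p ^ 2 + q ^ 2) * (6 * p ^ 4 + 6 * q ^ 4) + (24 * p ^ 5 + 24 * q ^ 5) ≤
        q ^ 8 + 12 * q ^ 7 + 52 * q ^ 6 + 120 * q ^ 5 + 288 * q ^ 4 + 384 * q ^ 3 + 1408 * q ^ 2 + 4864 := by
    intro p q hp hq hp2
    have hq0 := hq.le
    have e2 : p ^ 2 ≤ 4 := by nlinarith
    have e3 : p ^ 3 ≤ 8 := by nlinarith
    have e4 : p ^ 4 ≤ 16 := by nlinarith
    have e5 : p ^ 5 ≤ 32 := by nlinarith
    have hh : p ^ 2 + q ^ 2 ≤ 4 + q ^ 2 := by linarith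
    have hh0 : 0 ≤ p ^ 2 + q ^ 2 := by positivity
    have hh2 : (p ^ 2 + q ^ 2) ^ 2 ≤ (4 + q ^ 2) ^ 2 := pow_le_pow_left₀ hh0 hh 2
    have hh4 : (p ^ 2 + q ^ 2) ^ 4 ≤ (4 + q ^ 2) ^ 4 := pow_le_pow_left₀ hh0 hh 4
    have ha : 2 * p ^ 3 + 2 * q ^ 3 ≤ 16 + 2 * q ^ 3 := by linarith
    have ha0 : 0 ≤ 2 * p ^ 3 + 2 * q ^ 3 := by positivity
    have ha2 : (2 * p ^ 3 + 2 * q ^ 3) ^ 2 ≤ (16 + 2 * q ^ 3) ^ 2 := pow_le_pow_left₀ ha0 ha 2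
    have hb : 6 * p ^ 4 + 6 * q ^ 4 ≤ 96 + 6 * q ^ 4 := by linarith
    have hc : 24 * p ^ 5 + 24 * q ^ 5 ≤ 768 + 24 * q ^ 5 := by linarith
    have t2 : 6 * (p ^ 2 + q ^ 2) ^ 2 * (2 * p ^ 3 + 2 * q ^ 3) ≤ 6 * (4 + q ^ 2) ^ 2 * (16 + 2 * q ^ 3) := by
      have := mul_le_mul hh2 ha ha0 (by positivity); nlinarith
    have t4 : 4 * (p ^ 2 + q ^ 2) * (6 * p ^ 4 + 6 * q ^ 4) ≤ 4 * (4 + q ^ 2) * (96 + 6 * q ^ 4) := by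
      have := mul_le_mul hh hb (by positivity) (by positivity); nlinarith
    have e : (4 + q ^ 2) ^ 4 + 6 * (4 + q ^ 2) ^ 2 * (16 + 2 * q ^ 3) + 3 * (16 + 2 * q ^ 3) ^ 2 + 4 * (4 + q ^ 2) * (96 + 6 * q ^ 4) +
        (768 + 24 * q ^ 5) = q ^ 8 + 12 * q ^ 7 + 52 * q ^ 6 + 120 * q ^ 5 + 288 * q ^ 4 + 384 * q ^ 3 + 1408 * q ^ 2 + 4864 := by ring
    linarith
  rcases h with hu2 | hw2
  · have hw' := hmaj hu hw hu2
    have hwt := (klsd_logistic_weight_le hE).2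
    have hE' : Real.exp (u - w) ≤ Real.exp 2 * Real.exp (-w) := by
      rw [← Real.exp_add]; exact Real.exp_le_exp.2 (by linarith)
    calc _ ≤ Real.exp (u - w) * (w ^ 8 + 12 * w ^ 7 + 52 * w ^ 6 + 120 * w ^ 5 + 288 * w ^ 4 + 384 * w ^ 3 + 1408 * w ^ 2 + 4864) :=
          mul_le_mul hwt hw' hpoly0 hE.le
      _ ≤ (Real.exp 2 * Real.exp (-w)) * (w ^ 8 + 12 * w ^ 7 + 52 * w ^ 6 + 120 * w ^ 5 + 288 * w ^ 4 + 384 * w ^ 3 + 1408 * w ^ 2 + 4864) :=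
          mul_le_mul_of_nonneg_right hE' (by positivity)
      _ = Real.exp 2 * (Real.exp (-w) * (w ^ 8 + 12 * w ^ 7 + 52 * w ^ 6 + 120 * w ^ 5 + 288 * w ^ 4 + 384 * w ^ 3 + 1408 * w ^ 2 + 4864)) := by
          ring
      _ ≤ Real.exp 2 * 169536 := mul_le_mul_of_nonneg_left (hP w hw.le) (Real.exp_pos 2).le
      _ = 169536 * Real.exp 2 := by ring
  · have hu' : (u ^ 2 + w ^ 2) ^ 4 + 6 * (u ^ 2 + w ^ 2) ^ 2 * (2 * u ^ 3 + 2 * w ^ 3) + 3 * (2 * u ^ 3 + 2 * w ^ 3) ^ 2 +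
          4 * (u ^ 2 + w ^ 2) * (6 * u ^ 4 + 6 * w ^ 4) + (24 * u ^ 5 + 24 * w ^ 5) ≤
        u ^ 8 + 12 * u ^ 7 + 52 * u ^ 6 + 120 * u ^ 5 + 288 * u ^ 4 + 384 * u ^ 3 + 1408 * u ^ 2 + 4864 := by
      have h' := hmaj hw hu hw2
      have e1 : (w ^ 2 + u ^ 2) = (u ^ 2 + w ^ 2) := by ring
      have e2 : 2 * w ^ 3 + 2 * u ^ 3 = 2 * u ^ 3 + 2 * w ^ 3 := by ring
      have e3 : 6 * w ^ 4 + 6 * u ^ 4 = 6 * u ^ 4 + 6 * w ^ 4 := by ring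
      have e4 : 24 * w ^ 5 + 24 * u ^ 5 = 24 * u ^ 5 + 24 * w ^ 5 := by ring
      rw [e1, e2, e3, e4] at h'
      exact h'
    have hwt := (klsd_logistic_weight_le hE).1
    have hE' : (Real.exp (u - w))⁻¹ ≤ Real.exp 2 * Real.exp (-u) := by
      rw [← Real.exp_neg, ← Real.exp_add]; exact Real.exp_le_exp.2 (by linarith)
    calc _ ≤ (Real.exp (u - w))⁻¹ * (u ^ 8 + 12 * u ^ 7 + 52 * u ^ 6 + 120 * u ^ 5 + 288 * u ^ 4 + 384 * u ^ 3 + 1408 * u ^ 2 + 4864) :=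
          mul_le_mul hwt hu' hpoly0 (by positivity)
      _ ≤ (Real.exp 2 * Real.exp (-u)) * (u ^ 8 + 12 * u ^ 7 + 52 * u ^ 6 + 120 * u ^ 5 + 288 * u ^ 4 + 384 * u ^ 3 + 1408 * u ^ 2 + 4864) :=
          mul_le_mul_of_nonneg_right hE' (by positivity)
      _ = Real.exp 2 * (Real.exp (-u) * (u ^ 8 + 12 * u ^ 7 + 52 * u ^ 6 + 120 * u ^ 5 + 288 * u ^ 4 + 384 * u ^ 3 + 1408 * u ^ 2 + 4864)) := by
          ring
      _ ≤ Real.exp 2 * 169536 := mul_le_mul_of_nonneg_left (hP u hu.le) (Real.exp_pos 2).le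
      _ = 169536 * Real.exp 2 := by ring


/-! ## §3 `|σ⁗| ≤ 169536·e²` on `(0,1)`, everywhere, `χ₂⁗`, and the tier-2 package -/

/-- **`|smoothTransition⁗| ≤ 169536e²` on `(0,1)`.** -/
theorem kltd_abs_deriv4_smoothTransition_le_of_mem_Ioo {x : ℝ} (h0 : 0 < x) (h1 : x < 1) :
    |deriv (deriv (deriv (deriv Real.smoothTransition))) x| ≤ 169536 * Real.exp 2 := by
  have h1' : 0 < 1 - x := by linarith
  rw [kltd_deriv4_eq h0 h1]
  set u : ℝ := x⁻¹ with hu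
  set w : ℝ := (1 - x)⁻¹ with hw
  set sx : ℝ := (1 + Real.exp (u - w))⁻¹ with hsx
  have hupos : 0 < u := inv_pos.2 h0
  have hwpos : 0 < w := inv_pos.2 h1'
  have hE : 0 < Real.exp (u - w) := Real.exp_pos _
  have hs0 : 0 ≤ sx := by positivity
  have hs1 : sx ≤ 1 := inv_le_one_of_one_le₀ (by linarith)
  have hwt : sx * (1 - sx) = Real.exp (u - w) / (1 + Real.exp (u - w)) ^ 2 := by
    rw [hsx, klsd_weight_eq_logistic _ hE]
  have hwt0 : 0 ≤ sx * (1 - sx) := mul_nonneg hs0 (by linarith)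
  rw [abs_mul, abs_of_nonneg hwt0]
  have hc4 : |1 - 14 * sx + 36 * sx ^ 2 - 24 * sx ^ 3| ≤ 1 := by
    have hq1 : 0 ≤ 24 * sx ^ 2 - 36 * sx + 14 := by nlinarith [sq_nonneg (sx - 3 / 4)]
    have hq2 : 0 ≤ 24 * sx ^ 2 - 12 * sx + 2 := by nlinarith [sq_nonneg (sx - 1 / 4)]
    have e1 : 1 - (1 - 14 * sx + 36 * sx ^ 2 - 24 * sx ^ 3) = sx * (24 * sx ^ 2 - 36 * sx + 14) := by ring
    have e2 : (1 - 14 * sx + 36 * sx ^ 2 - 24 * sx ^ 3) - (-1) = (1 - sx) * (24 * sx ^ 2 - 12 * sx + 2) := by ring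
    rw [abs_le]; constructor
    · nlinarith [mul_nonneg (sub_nonneg.2 hs1) hq2]
    · nlinarith [mul_nonneg hs0 hq1]
  have hc3 : |1 - 6 * sx + 6 * sx ^ 2| ≤ 1 := by
    rw [abs_le]; constructor <;> nlinarith [sq_nonneg (sx - 1 / 2)]
  have hc2 : |1 - 2 * sx| ≤ 1 := by rw [abs_le]; constructor <;> linarith
  have hapos : 0 ≤ 2 * u ^ 3 + 2 * w ^ 3 := by positivity
  have hD : |-2 * u ^ 3 + 2 * w ^ 3| ≤ 2 * u ^ 3 + 2 * w ^ 3 := by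
    rw [abs_le]; constructor <;> nlinarith [pow_pos hupos 3, pow_pos hwpos 3]
  have hD2 : (-2 * u ^ 3 + 2 * w ^ 3) ^ 2 ≤ (2 * u ^ 3 + 2 * w ^ 3) ^ 2 := by
    have := sq_abs (-2 * u ^ 3 + 2 * w ^ 3)
    rw [← this]; exact pow_le_pow_left₀ (abs_nonneg _) hD 2
  -- the bracket, term by term
  have hA : |(1 - 14 * sx + 36 * sx ^ 2 - 24 * sx ^ 3) * (u ^ 2 + w ^ 2) ^ 4| ≤ (u ^ 2 + w ^ 2) ^ 4 := by
    rw [abs_mul, abs_of_nonneg (by positivity : (0:ℝ) ≤ (u ^ 2 + w ^ 2) ^ 4)]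
    exact (mul_le_mul_of_nonneg_right hc4 (by positivity)).trans (by rw [one_mul])
  have hB : |6 * (1 - 6 * sx + 6 * sx ^ 2) * (u ^ 2 + w ^ 2) ^ 2 * (-2 * u ^ 3 + 2 * w ^ 3)| ≤
      6 * (u ^ 2 + w ^ 2) ^ 2 * (2 * u ^ 3 + 2 * w ^ 3) := by
    rw [show 6 * (1 - 6 * sx + 6 * sx ^ 2) * (u ^ 2 + w ^ 2) ^ 2 * (-2 * u ^ 3 + 2 * w ^ 3) =
      (1 - 6 * sx + 6 * sx ^ 2) * ((6 * (u ^ 2 + w ^ 2) ^ 2) * (-2 * u ^ 3 + 2 * w ^ 3)) by ring, abs_mul, abs_mul,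
      abs_of_nonneg (by positivity : (0:ℝ) ≤ 6 * (u ^ 2 + w ^ 2) ^ 2)]
    calc |1 - 6 * sx + 6 * sx ^ 2| * (6 * (u ^ 2 + w ^ 2) ^ 2 * |-2 * u ^ 3 + 2 * w ^ 3|)
        ≤ 1 * (6 * (u ^ 2 + w ^ 2) ^ 2 * (2 * u ^ 3 + 2 * w ^ 3)) :=
          mul_le_mul hc3 (mul_le_mul_of_nonneg_left hD (by positivity)) (by positivity) zero_le_one
      _ = 6 * (u ^ 2 + w ^ 2) ^ 2 * (2 * u ^ 3 + 2 * w ^ 3) := one_mul _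
  have hC : |(1 - 2 * sx) * (3 * (-2 * u ^ 3 + 2 * w ^ 3) ^ 2 + 4 * (u ^ 2 + w ^ 2) * (6 * u ^ 4 + 6 * w ^ 4))| ≤
      3 * (2 * u ^ 3 + 2 * w ^ 3) ^ 2 + 4 * (u ^ 2 + w ^ 2) * (6 * u ^ 4 + 6 * w ^ 4) := by
    rw [abs_mul, abs_of_nonneg (by positivity : (0:ℝ) ≤ 3 * (-2 * u ^ 3 + 2 * w ^ 3) ^ 2 + 4 * (u ^ 2 + w ^ 2) * (6 * u ^ 4 + 6 * w ^ 4))]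
    calc |1 - 2 * sx| * (3 * (-2 * u ^ 3 + 2 * w ^ 3) ^ 2 + 4 * (u ^ 2 + w ^ 2) * (6 * u ^ 4 + 6 * w ^ 4))
        ≤ 1 * (3 * (2 * u ^ 3 + 2 * w ^ 3) ^ 2 + 4 * (u ^ 2 + w ^ 2) * (6 * u ^ 4 + 6 * w ^ 4)) :=
          mul_le_mul hc2 (by nlinarith) (by positivity) zero_le_one
      _ = _ := one_mul _
  have hDD : |-24 * u ^ 5 + 24 * w ^ 5| ≤ 24 * u ^ 5 + 24 * w ^ 5 := by
    rw [abs_le]; constructor <;> nlinarith [pow_pos hupos 5, pow_pos hwpos 5]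
  have hbr : |(1 - 14 * sx + 36 * sx ^ 2 - 24 * sx ^ 3) * (u ^ 2 + w ^ 2) ^ 4 +
        6 * (1 - 6 * sx + 6 * sx ^ 2) * (u ^ 2 + w ^ 2) ^ 2 * (-2 * u ^ 3 + 2 * w ^ 3) +
        (1 - 2 * sx) * (3 * (-2 * u ^ 3 + 2 * w ^ 3) ^ 2 + 4 * (u ^ 2 + w ^ 2) * (6 * u ^ 4 + 6 * w ^ 4)) +
        (-24 * u ^ 5 + 24 * w ^ 5)| ≤
      (u ^ 2 + w ^ 2) ^ 4 + 6 * (u ^ 2 + w ^ 2) ^ 2 * (2 * u ^ 3 + 2 * w ^ 3) + 3 * (2 * u ^ 3 + 2 * w ^ 3) ^ 2 +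
        4 * (u ^ 2 + w ^ 2) * (6 * u ^ 4 + 6 * w ^ 4) + (24 * u ^ 5 + 24 * w ^ 5) := by
    have s1 := (abs_add_le _ _).trans (add_le_add hA hB)
    have s2 := (abs_add_le _ _).trans (add_le_add s1 hC)
    have s3 := (abs_add_le _ _).trans (add_le_add s2 hDD)
    linarith
  have hcase : u ≤ 2 ∨ w ≤ 2 := by
    rcases le_or_gt x (1 / 2) with hx | hx
    · right; rw [hw, inv_le_comm₀ h1' (by norm_num)]; linarith
    · left; rw [hu, inv_le_comm₀ h0 (by norm_num)]; linarith
  calc sx * (1 - sx) * |(1 - 14 * sx + 36 * sx ^ 2 - 24 * sx ^ 3) * (u ^ 2 + w ^ 2) ^ 4 +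
          6 * (1 - 6 * sx + 6 * sx ^ 2) * (u ^ 2 + w ^ 2) ^ 2 * (-2 * u ^ 3 + 2 * w ^ 3) +
          (1 - 2 * sx) * (3 * (-2 * u ^ 3 + 2 * w ^ 3) ^ 2 + 4 * (u ^ 2 + w ^ 2) * (6 * u ^ 4 + 6 * w ^ 4)) +
          (-24 * u ^ 5 + 24 * w ^ 5)|
      ≤ sx * (1 - sx) * ((u ^ 2 + w ^ 2) ^ 4 + 6 * (u ^ 2 + w ^ 2) ^ 2 * (2 * u ^ 3 + 2 * w ^ 3) + 3 * (2 * u ^ 3 + 2 * w ^ 3) ^ 2 +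
          4 * (u ^ 2 + w ^ 2) * (6 * u ^ 4 + 6 * w ^ 4) + (24 * u ^ 5 + 24 * w ^ 5)) := mul_le_mul_of_nonneg_left hbr hwt0
    _ = Real.exp (u - w) / (1 + Real.exp (u - w)) ^ 2 *
          ((u ^ 2 + w ^ 2) ^ 4 + 6 * (u ^ 2 + w ^ 2) ^ 2 * (2 * u ^ 3 + 2 * w ^ 3) + 3 * (2 * u ^ 3 + 2 * w ^ 3) ^ 2 +
            4 * (u ^ 2 + w ^ 2) * (6 * u ^ 4 + 6 * w ^ 4) + (24 * u ^ 5 + 24 * w ^ 5)) := by rw [hwt]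
    _ ≤ 169536 * Real.exp 2 := kltd_core4_bound hupos hwpos hcase

/-- **`|smoothTransition⁗| ≤ 169536e²` on all of `ℝ`.** -/
theorem kltd_abs_deriv4_smoothTransition_le (x : ℝ) : |deriv (deriv (deriv (deriv Real.smoothTransition))) x| ≤ 169536 * Real.exp 2 := by
  -- off `[0,1]` the third derivative vanishes near the point (it is locally zero off `[0,1]`), hence so does the fourth
  have hzero3 : ∀ y : ℝ, y < 0 ∨ 1 < y → deriv (deriv (deriv Real.smoothTransition)) =ᶠ[𝓝 y] fun _ => (0 : ℝ) := by
    intro y hy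
    rcases hy with hy | hy
    · filter_upwards [Iio_mem_nhds hy] with z hz
      have hev : deriv (deriv Real.smoothTransition) =ᶠ[𝓝 z] fun _ => (0 : ℝ) := by
        filter_upwards [Iio_mem_nhds hz] with t ht
        have hev' : deriv Real.smoothTransition =ᶠ[𝓝 t] fun _ => (0 : ℝ) := by
          filter_upwards [Iio_mem_nhds ht] with r hr
          exact klcd_deriv_smoothTransition_eq_zero_of_neg hr
        rw [hev'.deriv_eq]; simp
      rw [hev.deriv_eq]; simp
    · filter_upwards [Ioi_mem_nhds hy] with z hz
      have hev : deriv (deriv Real.smoothTransition) =ᶠ[𝓝 z] fun _ => (0 : ℝ) := by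
        filter_upwards [Ioi_mem_nhds hz] with t ht
        have hev' : deriv Real.smoothTransition =ᶠ[𝓝 t] fun _ => (0 : ℝ) := by
          filter_upwards [Ioi_mem_nhds ht] with r hr
          have hev'' : Real.smoothTransition =ᶠ[𝓝 r] fun _ => (1 : ℝ) := by
            filter_upwards [Ioi_mem_nhds hr] with q hq
            exact Real.smoothTransition.one_of_one_le hq.le
          rw [hev''.deriv_eq]; simp
        rw [hev'.deriv_eq]; simp
      rw [hev.deriv_eq]; simp
  have hoff : ∀ y : ℝ, y < 0 ∨ 1 < y → deriv (deriv (deriv (deriv Real.smoothTransition))) y = 0 := by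
    intro y hy; rw [(hzero3 y hy).deriv_eq]; simp
  have hD : ∀ y ∈ ({0}ᶜ ∩ {1}ᶜ : Set ℝ), |deriv (deriv (deriv (deriv Real.smoothTransition))) y| ≤ 169536 * Real.exp 2 := by
    intro y hy
    have hy0 : y ≠ 0 := hy.1
    have hy1 : y ≠ 1 := hy.2
    rcases lt_or_gt_of_ne hy0 with h | h
    · rw [hoff y (Or.inl h), abs_zero]; positivity
    · rcases lt_or_gt_of_ne hy1 with h' | h'
      · exact kltd_abs_deriv4_smoothTransition_le_of_mem_Ioo h h'
      · rw [hoff y (Or.inr h'), abs_zero]; positivity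
  have hdense : Dense ({0}ᶜ ∩ {1}ᶜ : Set ℝ) :=
    (dense_compl_singleton 0).inter_of_isOpen_left (dense_compl_singleton 1) isOpen_compl_singleton
  have hcont : Continuous fun y => |deriv (deriv (deriv (deriv Real.smoothTransition))) y| := by
    have h4 : Continuous (iteratedDeriv 4 Real.smoothTransition) :=
      (Real.smoothTransition.contDiff (n := 4)).continuous_iteratedDeriv 4 le_rfl
    have heq : iteratedDeriv 4 Real.smoothTransition = deriv (deriv (deriv (deriv Real.smoothTransition))) := by
      rw [iteratedDeriv_succ, iteratedDeriv_succ, iteratedDeriv_succ, iteratedDeriv_one]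
    rw [heq] at h4
    exact h4.abs
  have hclosed : IsClosed {y : ℝ | |deriv (deriv (deriv (deriv Real.smoothTransition))) y| ≤ 169536 * Real.exp 2} :=
    isClosed_le hcont continuous_const
  have hsub : closure ({0}ᶜ ∩ {1}ᶜ : Set ℝ) ⊆ {y : ℝ | |deriv (deriv (deriv (deriv Real.smoothTransition))) y| ≤ 169536 * Real.exp 2} :=
    hclosed.closure_subset_iff.mpr hD
  rw [hdense.closure_eq] at hsub
  exact hsub (mem_univ x)

/-- The third derivative of `χ₂` as a function: `χ₂‴(x) = (4/3)³·σ‴((4x−1)/3)`. -/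
theorem kltd_deriv3_salmhoferCutoff_eq :
    deriv (deriv (deriv salmhoferCutoff)) = fun x => deriv (deriv (deriv Real.smoothTransition)) ((4 * x - 1) / 3) * (4 / 3) * (4 / 3) * (4 / 3) := by
  funext x
  rw [kltd_deriv2_salmhoferCutoff_eq]
  have hℓ : HasDerivAt (fun y : ℝ => (4 * y - 1) / 3) (4 / 3) x := by
    have := ((hasDerivAt_id x).const_mul 4).sub_const 1
    have := this.div_const 3
    simpa using this
  have hdiff : Differentiable ℝ (deriv (deriv Real.smoothTransition)) := by
    have h := (Real.smoothTransition.contDiff (n := 3)).differentiable_iteratedDeriv 2 (by norm_num)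
    rwa [iteratedDeriv_succ, iteratedDeriv_one] at h
  have hs : HasDerivAt (deriv (deriv Real.smoothTransition)) (deriv (deriv (deriv Real.smoothTransition)) ((4 * x - 1) / 3))
      ((4 * x - 1) / 3) := (hdiff _).hasDerivAt
  have hcomp : HasDerivAt (fun y => deriv (deriv Real.smoothTransition) ((4 * y - 1) / 3) * (4 / 3) * (4 / 3))
      (deriv (deriv (deriv Real.smoothTransition)) ((4 * x - 1) / 3) * (4 / 3) * (4 / 3) * (4 / 3)) x :=
    (((hs.comp x hℓ).congr_of_eventuallyEq (Eventually.of_forall fun y => rfl)).mul_const _).mul_const _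
  exact hcomp.deriv

/-- **`|χ₂⁗ x| ≤ (256/81)·169536·e²`.** -/
theorem kltd_abs_deriv4_salmhoferCutoff_le (x : ℝ) :
    |deriv (deriv (deriv (deriv salmhoferCutoff))) x| ≤ 256 / 81 * (169536 * Real.exp 2) := by
  rw [kltd_deriv3_salmhoferCutoff_eq]
  have hℓ : HasDerivAt (fun y : ℝ => (4 * y - 1) / 3) (4 / 3) x := by
    have := ((hasDerivAt_id x).const_mul 4).sub_const 1
    have := this.div_const 3
    simpa using this
  have hdiff : Differentiable ℝ (deriv (deriv (deriv Real.smoothTransition))) := by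
    have h := (Real.smoothTransition.contDiff (n := 4)).differentiable_iteratedDeriv 3 (by norm_num)
    rwa [iteratedDeriv_succ, iteratedDeriv_succ, iteratedDeriv_one] at h
  have hs : HasDerivAt (deriv (deriv (deriv Real.smoothTransition)))
      (deriv (deriv (deriv (deriv Real.smoothTransition))) ((4 * x - 1) / 3)) ((4 * x - 1) / 3) := (hdiff _).hasDerivAt
  have hcomp : HasDerivAt (fun y => deriv (deriv (deriv Real.smoothTransition)) ((4 * y - 1) / 3) * (4 / 3) * (4 / 3) * (4 / 3))
      (deriv (deriv (deriv (deriv Real.smoothTransition))) ((4 * x - 1) / 3) * (4 / 3) * (4 / 3) * (4 / 3) * (4 / 3)) x :=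
    ((((hs.comp x hℓ).congr_of_eventuallyEq (Eventually.of_forall fun y => rfl)).mul_const _).mul_const _).mul_const _
  rw [hcomp.deriv, abs_mul, abs_mul, abs_mul, abs_mul, abs_of_pos (by norm_num : (0:ℝ) < 4 / 3)]
  have := kltd_abs_deriv4_smoothTransition_le ((4 * x - 1) / 3)
  nlinarith [Real.exp_pos 2, abs_nonneg (deriv (deriv (deriv (deriv Real.smoothTransition))) ((4 * x - 1) / 3))]

/-- Numeric form: `|χ₂⁗ x| < 3960000` (`e² < 7.3891`). -/
theorem kltd_abs_deriv4_salmhoferCutoff_lt (x : ℝ) : |deriv (deriv (deriv (deriv salmhoferCutoff))) x| < 3960000 := by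
  have h := kltd_abs_deriv4_salmhoferCutoff_le x
  have he : Real.exp 1 < 2.7182818286 := Real.exp_one_lt_d9
  have he0 : 0 < Real.exp 1 := Real.exp_pos 1
  have h2 : Real.exp 2 = Real.exp 1 * Real.exp 1 := by rw [← Real.exp_add]; norm_num
  nlinarith

/-- **Order 4 in `iteratedFDeriv` form**: `‖D⁴χ₂(x)‖ ≤ 3960000`. -/
theorem norm_iteratedFDeriv_four_salmhoferCutoff_le (x : ℝ) : ‖iteratedFDeriv ℝ 4 salmhoferCutoff x‖ ≤ 3960000 := by
  rw [norm_iteratedFDeriv_eq_norm_iteratedDeriv, Real.norm_eq_abs, iteratedDeriv_succ, iteratedDeriv_succ, iteratedDeriv_succ, iteratedDeriv_one]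
  exact (kltd_abs_deriv4_salmhoferCutoff_lt x).le

/-- **THE TIER-2 CUTOFF NUMERAL**: `‖Dˡχ₂(x)‖ ≤ 3960000` for every `l ≤ 4` and every `x` (orders ≤ 2: p1b's tier-1 `1110`; order 3: `44900`; order 4: this file)
— a legitimate numeric `X ≥ 1` for every `hX : ∀ l ≤ 4, ‖Dˡχ₂‖ ≤ X` binder of the two-leg / Jackson-remainder doors. -/
theorem norm_iteratedFDeriv_salmhoferCutoff_le_of_le_four {l : ℕ} (hl : l ≤ 4) (x : ℝ) :
    ‖iteratedFDeriv ℝ l salmhoferCutoff x‖ ≤ 3960000 := by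
  rcases Nat.lt_or_ge l 3 with h | h
  · exact (norm_iteratedFDeriv_salmhoferCutoff_le_of_le_two (by omega) x).trans (by norm_num)
  · rcases Nat.lt_or_ge l 4 with h' | h'
    · obtain rfl : l = 3 := by omega
      exact (norm_iteratedFDeriv_three_salmhoferCutoff_le x).trans (by norm_num)
    · obtain rfl : l = 4 := le_antisymm hl h'
      exact norm_iteratedFDeriv_four_salmhoferCutoff_le x

end Summit.HubbardSuperconductivity.HubbardSuperconductivity.Theorems.KLRegimeSplit

end
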